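import Mathlib
import HarnessLib
import Summits.Ventures.LatticeQCDFlow.Exactness.KernelCouplingGaugeEquivariance
import Summits.Ventures.LatticeQCDFlow.Exactness.SpectralKernelMap

/-!
# The engine's `SU(N)` spectral plaquette coupling layer is gauge equivariant — end to end, from a permutation-equivariant eigenvalue map read through frozen invariant context

HONEST FRAMING: exact (Metropolis-corrected) sampling algorithms for lattice gauge theory;
figures of merit are autocorrelation/cost numbers at stated couplings and volumes; no
continuum-physics claim.

Venture `LatticeQCDFlow` (cell pub-lqcd), topic `Exactness`; FANOUT row 10 (`eng-equiv`, engine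
`latflow.equiv`, `spectral.SUNSpectralCoupling` (+ `flows_jax.sun_flow` / `scan_flow`, presets
`preset_boyda2021`, `preset_abbott2023`): "active links `U_μ(x)`, loop `W = U_μ(x) S(x)` with
frozen `S`, `W' = h(W | context)`, `U_μ(x)' = W' W† U_μ(x)`", the kernel `h` being the spectral
flow `V diag(λ) V† ↦ V diag(f λ) V†` with `f` permutation equivariant and its spline parameters
computed from gauge-INVARIANT frozen context).  NEW WORK of the cell; this file only ASSEMBLES:
the any-group layer theorem is `KernelCouplingGaugeEquivariance.lean`, the kernel's conjugation
equivariance and existence are `SpectralKernelConjugation.lean` / `SpectralKernelMap.lean`.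
Nothing is cited as a fact; no number; no definition is introduced.  Printed counterparts, NAMED
ONLY: Kanwar et al., PRL 125 (2020) 121601; Boyda et al., PRD 103 (2021) 074504 §II.B, §III,
App. A; Abbott et al., arXiv:2305.02402 §4.

## Content (`m` any finite index type, `SU(m) = Matrix.specialUnitaryGroup m ℂ`, `U(m) = Matrix.unitaryGroup m ℂ`; any `d`, `L`, mask `p`, plane choice `ν`)

* `spectralKernelField_gaugeInvariant` — a kernel field `h(V, e) : SU(m) → SU(m)` that AGREES
  with the spectral recipe of an eigenvalue-map field `f(V, e)` (on every unitary
  diagonalisation) is gauge invariant as a function of `V` as soon as `f` is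
  (`f(V^g, e) = f(V, e)`: the conditioner reads invariant context — plaquette traces,
  `SU2StapleFieldCovariance.isGaugeInvariant_tracePlaquetteFeatures`);
* **`isGaugeEquivariant_spectralCouplingLayer`** — THE LAYER on `GaugeConfig d L SU(m)`:
  `V(x,μ) ↦ h(V,(x,μ))(P) · P⁻¹ · V(x,μ)` on active links, `P = plaquetteHolonomy V x μ (ν(x,μ))`,
  frozen links unchanged, is `IsGaugeEquivariant` for every such agreeing kernel field with
  gauge-invariant `f`;
* **`exists_spectralCouplingKernel`** — such a kernel field EXISTS for every field of
  permutation-equivariant eigenvalue maps preserving unimodularity and `∏ λ = 1`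
  (`SpectralKernelMap.exists_spectralKernel_specialUnitaryGroup`, link by link); hence
  **`exists_isGaugeEquivariant_spectralCouplingLayer`**: the engine's construction — ANY
  permutation-equivariant admissible eigenvalue flow per active link with gauge-invariant
  parameters — yields a gauge-equivariant coupling layer whose kernel is determined by `f` on
  every diagonalisation;
* the `U(m)` twins `isGaugeEquivariant_spectralCouplingLayer_unitary`,
  `exists_isGaugeEquivariant_spectralCouplingLayer_unitary` (Boyda App. E: `U(N)` kernels, no
  determinant constraint).

NOT here: the layer's Jacobian w.r.t. Haar (Boyda eq. (19), Algorithm 2) and its exactness; the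
autoregressive / location variants (other choices of `p`, `ν` and of what `f` reads — covered as
long as what it reads is gauge invariant); any number.
-/

namespace Summit.Ventures.LatticeQCDFlow.Exactness

open Matrix
open Literature.MathematicalPhysics.QuantumFieldTheory

variable {d L : ℕ} {m : Type*} [Fintype m] [DecidableEq m]

/-! ## `SU(m)` links -/

section Special

/-- **An agreeing kernel field is gauge invariant when its eigenvalue map is.**  If `h(V, e)`
agrees with the spectral recipe of `f(V, e)` on every unitary diagonalisation and
`f(V^g, e) = f(V, e)` at active links, then `h(V^g, e) = h(V, e)` there. -/
theorem spectralKernelField_gaugeInvariant (p : Edge d L → Prop)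
    (f : GaugeConfig d L (Matrix.specialUnitaryGroup m ℂ) → Edge d L → (m → ℂ) → (m → ℂ))
    (h : GaugeConfig d L (Matrix.specialUnitaryGroup m ℂ) → Edge d L →
      Matrix.specialUnitaryGroup m ℂ → Matrix.specialUnitaryGroup m ℂ)
    (hagree : ∀ (V : GaugeConfig d L (Matrix.specialUnitaryGroup m ℂ)) (e : Edge d L)
      (P : Matrix.specialUnitaryGroup m ℂ) (W : Matrix m m ℂ) (c : m → ℂ), p e →
        W ∈ Matrix.unitaryGroup m ℂ → (P : Matrix m m ℂ) = W * diagonal c * star W →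
          ((h V e P : Matrix.specialUnitaryGroup m ℂ) : Matrix m m ℂ) = W * diagonal (f V e c) * star W)
    (hfinv : ∀ (g : Site d L → Matrix.specialUnitaryGroup m ℂ)
      (V : GaugeConfig d L (Matrix.specialUnitaryGroup m ℂ)) (e : Edge d L), p e →
        f (gaugeTransform g V) e = f V e)
    (g : Site d L → Matrix.specialUnitaryGroup m ℂ)
    (V : GaugeConfig d L (Matrix.specialUnitaryGroup m ℂ)) (e : Edge d L) (he : p e) :
    h (gaugeTransform g V) e = h V e := by
  funext P
  obtain ⟨W, hW, c, hP⟩ :=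
    exists_eq_conj_diagonal_of_mem_unitaryGroup (Matrix.mem_specialUnitaryGroup_iff.mp P.2).1
  apply Subtype.ext
  rw [hagree _ e P W c he hW hP, hagree V e P W c he hW hP, hfinv g V e he]

/-- **The `SU(m)` spectral plaquette coupling layer is gauge equivariant.**  For any mask `p`,
plane choice `ν`, eigenvalue-map field `f` that is gauge invariant at active links, and kernel
field `h` agreeing with the spectral recipe of `f` on every unitary diagonalisation, the layer
`V(x,μ) ↦ h(V,(x,μ))(P) P⁻¹ V(x,μ)` (`P` the plaquette through the active link in the plane
`ν`), frozen links unchanged, is `IsGaugeEquivariant`. -/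
theorem isGaugeEquivariant_spectralCouplingLayer (p : Edge d L → Prop) [DecidablePred p]
    (ν : Edge d L → Fin d)
    (f : GaugeConfig d L (Matrix.specialUnitaryGroup m ℂ) → Edge d L → (m → ℂ) → (m → ℂ))
    (h : GaugeConfig d L (Matrix.specialUnitaryGroup m ℂ) → Edge d L →
      Matrix.specialUnitaryGroup m ℂ → Matrix.specialUnitaryGroup m ℂ)
    (hagree : ∀ (V : GaugeConfig d L (Matrix.specialUnitaryGroup m ℂ)) (e : Edge d L)
      (P : Matrix.specialUnitaryGroup m ℂ) (W : Matrix m m ℂ) (c : m → ℂ), p e →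
        W ∈ Matrix.unitaryGroup m ℂ → (P : Matrix m m ℂ) = W * diagonal c * star W →
          ((h V e P : Matrix.specialUnitaryGroup m ℂ) : Matrix m m ℂ) = W * diagonal (f V e c) * star W)
    (hfinv : ∀ (g : Site d L → Matrix.specialUnitaryGroup m ℂ)
      (V : GaugeConfig d L (Matrix.specialUnitaryGroup m ℂ)) (e : Edge d L), p e →
        f (gaugeTransform g V) e = f V e) :
    IsGaugeEquivariant (fun (V : GaugeConfig d L (Matrix.specialUnitaryGroup m ℂ)) (e : Edge d L) =>
      if p e then h V e (plaquetteHolonomy V e.1 e.2 (ν e)) * (plaquetteHolonomy V e.1 e.2 (ν e))⁻¹ * V e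
      else V e) :=
  isGaugeEquivariant_plaquetteKernelLayer p ν h
    (fun g V e he => spectralKernelField_gaugeInvariant p f h hagree hfinv g V e he)
    (fun V e a b he => spectralKernel_specialUnitaryGroup_conj (f := f V e) (h := h V e)
      (fun P W c hW hP => hagree V e P W c he hW hP) a b)

/-- **The kernel field exists** for every field of permutation-equivariant eigenvalue maps that
preserve unimodularity and the constraint `∏ λ = 1` (link by link,
`exists_spectralKernel_specialUnitaryGroup`). -/
theorem exists_spectralCouplingKernel
    (f : GaugeConfig d L (Matrix.specialUnitaryGroup m ℂ) → Edge d L → (m → ℂ) → (m → ℂ))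
    (hperm : ∀ V e (σ : Equiv.Perm m) (c : m → ℂ), f V e (fun k => c (σ k)) = fun k => f V e c (σ k))
    (hnorm : ∀ V e (c : m → ℂ), (∀ i, ‖c i‖ = 1) → ∀ i, ‖f V e c i‖ = 1)
    (hprod : ∀ V e (c : m → ℂ), (∀ i, ‖c i‖ = 1) → ∏ i, c i = 1 → ∏ i, f V e c i = 1) :
    ∃ h : GaugeConfig d L (Matrix.specialUnitaryGroup m ℂ) → Edge d L →
        Matrix.specialUnitaryGroup m ℂ → Matrix.specialUnitaryGroup m ℂ,
      ∀ (V : GaugeConfig d L (Matrix.specialUnitaryGroup m ℂ)) (e : Edge d L)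
        (P : Matrix.specialUnitaryGroup m ℂ) (W : Matrix m m ℂ) (c : m → ℂ),
        W ∈ Matrix.unitaryGroup m ℂ → (P : Matrix m m ℂ) = W * diagonal c * star W →
          ((h V e P : Matrix.specialUnitaryGroup m ℂ) : Matrix m m ℂ) = W * diagonal (f V e c) * star W := by
  have hex : ∀ (V : GaugeConfig d L (Matrix.specialUnitaryGroup m ℂ)) (e : Edge d L),
      ∃ h : Matrix.specialUnitaryGroup m ℂ → Matrix.specialUnitaryGroup m ℂ,
        ∀ (P : Matrix.specialUnitaryGroup m ℂ) (W : Matrix m m ℂ) (c : m → ℂ),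
          W ∈ Matrix.unitaryGroup m ℂ → (P : Matrix m m ℂ) = W * diagonal c * star W →
            ((h P : Matrix.specialUnitaryGroup m ℂ) : Matrix m m ℂ) = W * diagonal (f V e c) * star W :=
    fun V e => exists_spectralKernel_specialUnitaryGroup (hperm V e) (hnorm V e) (hprod V e)
  choose h hh using hex
  exact ⟨h, hh⟩

/-- **The engine's construction yields a gauge-equivariant layer (existence form).**  For every
mask, plane choice and field of permutation-equivariant admissible eigenvalue maps `f` that is
gauge invariant at active links, there is a kernel field `h` agreeing with the spectral recipe of
`f` on every unitary diagonalisation, and the resulting spectral plaquette coupling layer is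
`IsGaugeEquivariant`. -/
theorem exists_isGaugeEquivariant_spectralCouplingLayer (p : Edge d L → Prop) [DecidablePred p]
    (ν : Edge d L → Fin d)
    (f : GaugeConfig d L (Matrix.specialUnitaryGroup m ℂ) → Edge d L → (m → ℂ) → (m → ℂ))
    (hperm : ∀ V e (σ : Equiv.Perm m) (c : m → ℂ), f V e (fun k => c (σ k)) = fun k => f V e c (σ k))
    (hnorm : ∀ V e (c : m → ℂ), (∀ i, ‖c i‖ = 1) → ∀ i, ‖f V e c i‖ = 1)
    (hprod : ∀ V e (c : m → ℂ), (∀ i, ‖c i‖ = 1) → ∏ i, c i = 1 → ∏ i, f V e c i = 1)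
    (hfinv : ∀ (g : Site d L → Matrix.specialUnitaryGroup m ℂ)
      (V : GaugeConfig d L (Matrix.specialUnitaryGroup m ℂ)) (e : Edge d L), p e →
        f (gaugeTransform g V) e = f V e) :
    ∃ h : GaugeConfig d L (Matrix.specialUnitaryGroup m ℂ) → Edge d L →
        Matrix.specialUnitaryGroup m ℂ → Matrix.specialUnitaryGroup m ℂ,
      (∀ (V : GaugeConfig d L (Matrix.specialUnitaryGroup m ℂ)) (e : Edge d L)
          (P : Matrix.specialUnitaryGroup m ℂ) (W : Matrix m m ℂ) (c : m → ℂ),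
          W ∈ Matrix.unitaryGroup m ℂ → (P : Matrix m m ℂ) = W * diagonal c * star W →
            ((h V e P : Matrix.specialUnitaryGroup m ℂ) : Matrix m m ℂ) = W * diagonal (f V e c) * star W) ∧
      IsGaugeEquivariant (fun (V : GaugeConfig d L (Matrix.specialUnitaryGroup m ℂ)) (e : Edge d L) =>
        if p e then h V e (plaquetteHolonomy V e.1 e.2 (ν e)) * (plaquetteHolonomy V e.1 e.2 (ν e))⁻¹ * V e
        else V e) := by
  obtain ⟨h, hh⟩ := exists_spectralCouplingKernel f hperm hnorm hprod
  exact ⟨h, hh, isGaugeEquivariant_spectralCouplingLayer p ν f h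
    (fun V e P W c _ hW hP => hh V e P W c hW hP) hfinv⟩

end Special

/-! ## `U(m)` links (Boyda App. E: no determinant constraint) -/

section UnitaryLinks

/-- **The `U(m)` spectral plaquette coupling layer is gauge equivariant** (same statement on
`GaugeConfig d L U(m)`). -/
theorem isGaugeEquivariant_spectralCouplingLayer_unitary (p : Edge d L → Prop) [DecidablePred p]
    (ν : Edge d L → Fin d)
    (f : GaugeConfig d L (Matrix.unitaryGroup m ℂ) → Edge d L → (m → ℂ) → (m → ℂ))
    (h : GaugeConfig d L (Matrix.unitaryGroup m ℂ) → Edge d L →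
      Matrix.unitaryGroup m ℂ → Matrix.unitaryGroup m ℂ)
    (hagree : ∀ (V : GaugeConfig d L (Matrix.unitaryGroup m ℂ)) (e : Edge d L)
      (P : Matrix.unitaryGroup m ℂ) (W : Matrix m m ℂ) (c : m → ℂ), p e →
        W ∈ Matrix.unitaryGroup m ℂ → (P : Matrix m m ℂ) = W * diagonal c * star W →
          ((h V e P : Matrix.unitaryGroup m ℂ) : Matrix m m ℂ) = W * diagonal (f V e c) * star W)
    (hfinv : ∀ (g : Site d L → Matrix.unitaryGroup m ℂ)
      (V : GaugeConfig d L (Matrix.unitaryGroup m ℂ)) (e : Edge d L), p e →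
        f (gaugeTransform g V) e = f V e) :
    IsGaugeEquivariant (fun (V : GaugeConfig d L (Matrix.unitaryGroup m ℂ)) (e : Edge d L) =>
      if p e then h V e (plaquetteHolonomy V e.1 e.2 (ν e)) * (plaquetteHolonomy V e.1 e.2 (ν e))⁻¹ * V e
      else V e) := by
  refine isGaugeEquivariant_plaquetteKernelLayer p ν h (fun g V e he => ?_)
    (fun V e a b he => spectralKernel_unitaryGroup_conj (f := f V e) (h := h V e)
      (fun P W c hW hP => hagree V e P W c he hW hP) a b)
  funext P
  obtain ⟨W, hW, c, hP⟩ := exists_eq_conj_diagonal_of_mem_unitaryGroup P.2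
  apply Subtype.ext
  rw [hagree _ e P W c he hW hP, hagree V e P W c he hW hP, hfinv g V e he]

/-- **Existence form on `U(m)`**: any field of permutation-equivariant, unimodularity-preserving
eigenvalue maps that is gauge invariant at active links has an agreeing kernel field, and the
resulting spectral plaquette coupling layer is `IsGaugeEquivariant`. -/
theorem exists_isGaugeEquivariant_spectralCouplingLayer_unitary (p : Edge d L → Prop) [DecidablePred p]
    (ν : Edge d L → Fin d)
    (f : GaugeConfig d L (Matrix.unitaryGroup m ℂ) → Edge d L → (m → ℂ) → (m → ℂ))
    (hperm : ∀ V e (σ : Equiv.Perm m) (c : m → ℂ), f V e (fun k => c (σ k)) = fun k => f V e c (σ k))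
    (hnorm : ∀ V e (c : m → ℂ), (∀ i, ‖c i‖ = 1) → ∀ i, ‖f V e c i‖ = 1)
    (hfinv : ∀ (g : Site d L → Matrix.unitaryGroup m ℂ)
      (V : GaugeConfig d L (Matrix.unitaryGroup m ℂ)) (e : Edge d L), p e →
        f (gaugeTransform g V) e = f V e) :
    ∃ h : GaugeConfig d L (Matrix.unitaryGroup m ℂ) → Edge d L →
        Matrix.unitaryGroup m ℂ → Matrix.unitaryGroup m ℂ,
      (∀ (V : GaugeConfig d L (Matrix.unitaryGroup m ℂ)) (e : Edge d L)
          (P : Matrix.unitaryGroup m ℂ) (W : Matrix m m ℂ) (c : m → ℂ),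
          W ∈ Matrix.unitaryGroup m ℂ → (P : Matrix m m ℂ) = W * diagonal c * star W →
            ((h V e P : Matrix.unitaryGroup m ℂ) : Matrix m m ℂ) = W * diagonal (f V e c) * star W) ∧
      IsGaugeEquivariant (fun (V : GaugeConfig d L (Matrix.unitaryGroup m ℂ)) (e : Edge d L) =>
        if p e then h V e (plaquetteHolonomy V e.1 e.2 (ν e)) * (plaquetteHolonomy V e.1 e.2 (ν e))⁻¹ * V e
        else V e) := by
  have hex : ∀ (V : GaugeConfig d L (Matrix.unitaryGroup m ℂ)) (e : Edge d L),
      ∃ h : Matrix.unitaryGroup m ℂ → Matrix.unitaryGroup m ℂ,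
        ∀ (P : Matrix.unitaryGroup m ℂ) (W : Matrix m m ℂ) (c : m → ℂ),
          W ∈ Matrix.unitaryGroup m ℂ → (P : Matrix m m ℂ) = W * diagonal c * star W →
            ((h P : Matrix.unitaryGroup m ℂ) : Matrix m m ℂ) = W * diagonal (f V e c) * star W :=
    fun V e => exists_spectralKernel_unitaryGroup (hperm V e) (hnorm V e)
  choose h hh using hex
  exact ⟨h, hh, isGaugeEquivariant_spectralCouplingLayer_unitary p ν f h
    (fun V e P W c _ hW hP => hh V e P W c hW hP) hfinv⟩

end UnitaryLinks

end Summit.Ventures.LatticeQCDFlow.Exactness
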